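import Mathlib
import Summits.NavierStokesRegularity.NavierStokesRegularity.Theorems.TypeIQuarterGateScarEnvelopeTypeISatelliteTowerHullBirkhoff
import Summits.NavierStokesRegularity.NavierStokesRegularity.Theses.RecurrentProfiles

/-!
# Satellite tower for crux `ScarEnvelopeTypeI` (stmt-NavierStokesRegularity-23843) — ROUND-45 Z12: EDGE 1589 ⇒ (ρ) (crux `RecurrentProfiles.RecurrentLiouville` forbids uniformly recurrent doubly-minimal rooted census objects); neither item proved; NOT a proof of 23843

Z12 of nsreg-p3 g28's ROUND-45 artefact (landing form (25b′); ref3 R45-F2 «EDGE module only»), landed as a separate EDGE module on director-ns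
DIRECTOR-NS #262's ruling («EDGE 1589 ⇒ 23843; neither item proved; not a proof of 23843» — same status as `…SatelliteTowerHullEdge` (ROUND-44 Z9)):
`noRecurrentDoublyMin_of_recurrentLiouville` takes the registered OPEN crux
`Summit.NavierStokesRegularity.NavierStokesRegularity.Theses.RecurrentProfiles.RecurrentLiouville` (stmt-NavierStokesRegularity-1589) as a HYPOTHESIS and
refutes the (ρ)-enemy of Z11 (a doubly-minimal rooted census object is a uniformly recurrent Type-I singularity model of the Albritton–Barker class,
`ABTower.prClass`): (ρ) is a RESTRICTION of crux 1589.  Z12′ `scarEnvelopeTypeI_of_recurrentLiouville'` (= Z11 ∘ Z12) is NOT landed: it restates the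
already-landed edge `…SatelliteTowerHullEdge.scarEnvelopeTypeI_of_recurrentLiouville` (ROUND-44 Z9, p666018) — gate `dedup.landed` on p669470; it stays in
the pub plate.  CONDITIONAL: 1589 is OPEN, so this proves NEITHER item; item 23843's status is unchanged by this module.

PROVENANCE: declaration texts VERBATIM from the HOME artefact of the instrument seat nsreg-p3 g28 (cell `pub/ns-regularity-ideate`):
`round-45/Birkhoff45.lean` (sha16 `f8170ff5aabdcd25`, parts `partA45…partD45.lean`; a module written against the TREE, importing route
RecurrentProfiles' crux-1589 dynamics modules and the Literature dynamics BY NAME; its Part Z = ROUND-44 is already in the tree as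
`…SatelliteTowerHullJunction/…HullDichotomy/…DssNecklace/…DssCell/…HullCells/…HullEdge`, p664756…p666018), scored by referee ref3
(`SCORE-p3-ROUND-45-0828.md` cba78f676c9340cc, PASS TEXT+LEAN ★★ 21:02:16Z); the author cannot write under `Theorems/` (`perm.theorems-prover-only`); landed by the prover
ns-es-p1 g6 as landing hand of record (director-ns DIRECTOR-NS #237 (3)), split into ≤ 400-line modules, the artefact's
`#guard_msgs … #print axioms` certificates not landed.  `--supports stmt-NavierStokesRegularity-23843 --as helper`.

HONEST FRAMING: NORMAL FORM / JUNCTION / MECHANISM / METER theorems about HYPOTHETICAL Type-I zoom limits (Albritton–Barker objects of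
the census of crux `TypeIQuarterGate.ScarEnvelopeTypeI`, item 23843).  Movement 0 on anything open: item 23843, route TypeIQuarterGate,
crux 1589 `RecurrentLiouville`, crux 22144 `FiniteDissipationLiouville`, the statements (ρ), (θ′), (υ), the DSS cells (τ), (κ), N0 and
Navier–Stokes regularity are all OPEN — NS regularity is NOT proved here.  IN-TREE DISCLOSURE (cited by name, not re-derived):
Furstenberg 1981 Thms 1.15/1.17 (`Literature/Dynamics/TopologicalDynamics/{UniformRecurrence,MinimalOrbitClosure}.lean`), the `L³_loc`
slab-field model `SlabField` (`Literature/Analysis/FluidPDE/ScalingRecurrentSlabField.lean`), `exists_orbit_limit` (Albritton–Barker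
compactness), `stub_prJointContinuity`, `rlNearIdentityDSS_ae_comp_dilation` (route RecurrentProfiles / SqueezeCycle lineage), the PROVED
tree theorem `pineauVicol2026_oneSlice_regularity_holds` (Pineau–Vicol 2026 Thm 1.9) and the KNSS pressure package
`ChiralWindowDoorClassDerivDecay.exists_classical_scaleInvariantBounds_of_class`.  The same two moves exist EARLIER in crux 22144's
lineage (`FiniteDissipationLiouville.…HullCategoryMinimal.recurrent_of_orbitLimit`, `…Envelope.pv_unsteadiness_floor_of_minimal`) for a
different class; here they are proved independently for the Albritton–Barker class — NOT a new mechanism.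
-/

-- the summit-side namespace repeats a component by design (single-conjunct summit, D-0017)
set_option linter.dupNamespace false

open MeasureTheory Set Metric Filter Topology
open scoped ENNReal NNReal InnerProductSpace
open Literature.Analysis.FluidPDE
open Literature.Dynamics.TopologicalDynamics

namespace Summit.NavierStokesRegularity.NavierStokesRegularity.Cruxes.ScarEnvelopeTypeI.ZoomDictionary

section HullJunction

variable {U U₁ U₂ W : ℝ → (EuclideanSpace ℝ (Fin 3)) → (EuclideanSpace ℝ (Fin 3))}
  {P : ℝ → (EuclideanSpace ℝ (Fin 3)) → ℝ}
  {H : ℝ → (EuclideanSpace ℝ (Fin 3)) → (EuclideanSpace ℝ (Fin 3)) →L[ℝ] (EuclideanSpace ℝ (Fin 3))}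
  {M : ℝ}

/-- ★ **Z12.  (ρ) ⟸ crux 1589.**  A doubly-minimal rooted census object is a uniformly recurrent Type-I singularity
model of the Albritton–Barker class (`ABTower.prClass`, Z1), so `RecurrentLiouville` forbids it: (ρ) is a
RESTRICTION of crux 1589, and Z11 ∘ Z12 re-proves Z9. -/
theorem noRecurrentDoublyMin_of_recurrentLiouville
    (hRL : Summit.NavierStokesRegularity.NavierStokesRegularity.Theses.RecurrentProfiles.RecurrentLiouville)
    (M : ℝ) (I₀ : ℝ≥0∞) (U : ℝ → (EuclideanSpace ℝ (Fin 3)) → (EuclideanSpace ℝ (Fin 3)))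
    (P : ℝ → (EuclideanSpace ℝ (Fin 3)) → ℝ)
    (H : ℝ → (EuclideanSpace ℝ (Fin 3)) → (EuclideanSpace ℝ (Fin 3)) →L[ℝ] (EuclideanSpace ℝ (Fin 3)))
    (_hI₀ : I₀ < ⊤) (_hcrit : levelCrit I₀ ∈ Icc epsL M) (_hmin : minLevel I₀ ≤ I₀)
    (hdm : ∀ y : (EuclideanSpace ℝ (Fin 3)), DoublyMin I₀ ⟨U, P, H, y⟩) (h0 : ¬ RegPt U 0)
    (hrec : IsScalingUniformlyRecurrent U) : False := by
  have hT : ABTower (levelCrit I₀) U P H := (hdm 0).1.1.1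
  obtain ⟨hsw, hgr, hIb, hd⟩ := hT.prClass
  refine hRL U P H (levelCrit I₀) hsw hgr hIb hd hrec ?_
  rw [prod_zero_eq]
  exact isBackwardSingularPoint_of_not_regPt h0

end HullJunction

end Summit.NavierStokesRegularity.NavierStokesRegularity.Cruxes.ScarEnvelopeTypeI.ZoomDictionary
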